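import Summits.BirchSwinnertonDyer.BirchSwinnertonDyer.Theses.InertQuadraticUntwist
import HarnessLib

/-! # Birth skeleton (BC3) for crux `Summit.BirchSwinnertonDyer.BirchSwinnertonDyer.Theses.InertQuadraticUntwist.ThetaAdicLFunctionTprime` of route InertQuadraticUntwist
(planner bsd-wall-pss3 g12, 2026-08-28; v2 = pss3 g15 fix of `skeleton.extra-hypothesis`: the composition is a CLOSED theorem over the
declared stubs, stub statements unchanged). Sorries ONLY inside `stub_*`; `ThetaAdicLFunctionTprime_of` concludes the route decl by name. -/

set_option linter.dupNamespace false
set_option autoImplicit false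

noncomputable section

open scoped Classical

open WeierstrassCurve CongruenceSubgroup
  Literature.NumberTheory.EllipticCurves
  Literature.NumberTheory.EllipticCurves.ModularForms
  Literature.NumberTheory.EllipticCurves.Rank1Residual
  Literature.NumberTheory.IwasawaTheory
open Summit.BirchSwinnertonDyer.BirchSwinnertonDyer.Theses.InertQuadraticUntwist

namespace Summit.BirchSwinnertonDyer.BirchSwinnertonDyer.Cruxes.ThetaAdicLFunctionTprime.Birth

/-! ## BC3 skeleton of `ThetaAdicLFunctionTprime` (K0): explicit reciprocity at SOME order ν < 1, then the
growth improvement to ½ (isoclinic slope-½ isocrystal over ℚ₉); composition by Višik-free pure logic. -/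

/-- stub (ERL over ℚ₉, crude growth): on (t′) rows there is an additive system of ball values of SOME growth
order ν < 1 with the θ-adic interpolation law (intended: θ-Coleman image of Kato's zeta element, growth read
off Perrin-Riou's regulator with h = 1). -/
theorem stub_thetaERL_someOrder :
    ∀ (W : WeierstrassCurve ℚ) [W.IsElliptic] [W.IsGloballyMinimal],
    ¬ W.HasCM → Addv W 3 → Summit.BirchSwinnertonDyer.Rank1Residual.Additive.SubTprime W 3 →
      ∃ ν : ℝ, ν < 1 ∧ ∃ μ : (n : ℕ) → ZMod (3 ^ n) → ℂ_[3],
        ∃ (N : ℕ) (_ : NeZero N) (f : CuspForm (Gamma0 N) 2), IsNewformOf W f ∧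
          IsGammaDistribution 3 μ ∧ HasGrowthOrder 3 ν μ ∧
          ∃ (e : ℕ → ℂ_[3]) (κ₀ κ₁ ρ : ℝ), 0 < κ₀ ∧ 0 < κ₁ ∧ 1 ≤ ρ ∧
            (∀ m : ℕ, ‖e m‖ = (if Even m then κ₀ else κ₁) * ρ ^ m) ∧
            ∀ (m : ℕ) (ξ : DirichletCharacter ℂ_[3] (3 ^ m)), ξ.IsPrimitive → ξ.Even →
              (∃ j : ℕ, orderOf ξ = 3 ^ j) →
                gammaCharValue 3 μ ξ = e m * ratTwistedSymbolSum f ξ := by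
  sorry

/-- stub (growth ½): every additive system with the θ-adic interpolation law and some growth order ν < 1 can be
replaced by one of growth order ½ with the same kind of law (intended: the θ-coordinate of the regulator on an
isoclinic slope-½ isocrystal has order exactly ½; uniqueness below order 1 makes "replaced by" harmless). -/
theorem stub_thetaGrowthHalf :
    ∀ (W : WeierstrassCurve ℚ) [W.IsElliptic] [W.IsGloballyMinimal],
    ¬ W.HasCM → Addv W 3 → Summit.BirchSwinnertonDyer.Rank1Residual.Additive.SubTprime W 3 →
      ∀ ν : ℝ, ν < 1 → ∀ μ : (n : ℕ) → ZMod (3 ^ n) → ℂ_[3],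
        (∃ (N : ℕ) (_ : NeZero N) (f : CuspForm (Gamma0 N) 2), IsNewformOf W f ∧
          IsGammaDistribution 3 μ ∧ HasGrowthOrder 3 ν μ ∧
          ∃ (e : ℕ → ℂ_[3]) (κ₀ κ₁ ρ : ℝ), 0 < κ₀ ∧ 0 < κ₁ ∧ 1 ≤ ρ ∧
            (∀ m : ℕ, ‖e m‖ = (if Even m then κ₀ else κ₁) * ρ ^ m) ∧
            ∀ (m : ℕ) (ξ : DirichletCharacter ℂ_[3] (3 ^ m)), ξ.IsPrimitive → ξ.Even →
              (∃ j : ℕ, orderOf ξ = 3 ^ j) →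
                gammaCharValue 3 μ ξ = e m * ratTwistedSymbolSum f ξ) →
        ∃ μ : (n : ℕ) → ZMod (3 ^ n) → ℂ_[3],
        ∃ (N : ℕ) (_ : NeZero N) (f : CuspForm (Gamma0 N) 2), IsNewformOf W f ∧
          IsGammaDistribution 3 μ ∧ HasGrowthOrder 3 (1 / 2) μ ∧
          ∃ (e : ℕ → ℂ_[3]) (κ₀ κ₁ ρ : ℝ), 0 < κ₀ ∧ 0 < κ₁ ∧ 1 ≤ ρ ∧
            (∀ m : ℕ, ‖e m‖ = (if Even m then κ₀ else κ₁) * ρ ^ m) ∧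
            ∀ (m : ℕ) (ξ : DirichletCharacter ℂ_[3] (3 ^ m)), ξ.IsPrimitive → ξ.Even →
              (∃ j : ℕ, orderOf ξ = 3 ^ j) →
                gammaCharValue 3 μ ξ = e m * ratTwistedSymbolSum f ξ := by
  sorry

/-- COMPOSITION (line `birth` v2, kernel-checked, CLOSED over the declared stubs — v1's `_of` took the two
stub statements as raw `∀`-binders `(h₁ …) (h₂ …)`, which the skeleton audit reads as `skeleton.extra-hypothesis`):
the route crux `ThetaAdicLFunctionTprime` (K0) BY NAME (type literally the route decl) from `stub_thetaERL_someOrder`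
(some growth order ν < 1) and `stub_thetaGrowthHalf` (improvement to order ½) — pure logic. -/
theorem ThetaAdicLFunctionTprime_of :
    Summit.BirchSwinnertonDyer.BirchSwinnertonDyer.Theses.InertQuadraticUntwist.ThetaAdicLFunctionTprime := by
  intro W _ _ hCM hadd ht
  obtain ⟨ν, hν, μ, hμ⟩ := stub_thetaERL_someOrder W hCM hadd ht
  exact stub_thetaGrowthHalf W hCM hadd ht ν hν μ hμ

end Summit.BirchSwinnertonDyer.BirchSwinnertonDyer.Cruxes.ThetaAdicLFunctionTprime.Birth

end
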